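import Mathlib
import Literature.Analysis.FluidPDE.Tao2016AveragedNS.RestartedCascadeFlows
import HarnessLib

/-!
# `GappedFrontRobust`, tools for the (step) clause: COMPARISON of a pseudo-flow with an exact flow
  (integral form of the motion law, bilinear difference bound for the quadratic term, and the
  uniform bootstrap lemma for a family of shells; helper for item stmt-NavierStokesRegularity-20423,
  crux K_B of routes TaoLadderRungThree / TaoLadderRungTwo / TaoLadderRungTwoPoly and its announced
  restatement over `GapData₂`)

HONEST FRAMING: elementary real-analysis lemmas about Tao-type MODEL lattice pseudo-flows (Tao 2016, §4
Lemma 4.1 (4.8): the equation of motion with defect `κ₁ (1+ε₀)^{2k} √F`), in the cell vocabulary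
`TaoCascade.PseudoFlowOn` / `quadTerm` of the tree modules `RestartedCascadeFlows` / `TaoCascadeODE`, plus
one abstract continuity ("bootstrap") lemma. Nothing here is a statement about the Navier–Stokes
equations, and nothing is asserted about any table.

WHAT THIS IS FOR. The (step) clause `RobustStep` of K_B is a continuous-dependence statement: an
`(η, η)`-pseudo-flow `S̃` from a ball state is compared with the exact flow `S` of the gap certificate on
one clock window, shell by shell, in a weighted sup norm (behind the front and on the finitely many
active shells; the far tail is handled by `…GappedFrontRobustTailEnergy` / `…TailStep`). The three
ingredients of that comparison which do not depend on the certificate format are proved here: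

* `pseudoFlowOn_motion_integral` — the motion law (4.8) in integral form,
  `|S_{i,k}(s) − S₀_{i,k} − ∫₀^s quadTerm(S)_{i,k}| ≤ ∫₀^s κ₁ (1+ε₀)^{2k} √F_{i,k}`, and its exact case
  `pseudoFlowOn_exact_motion_integral` (`κ₁ = 0`: equality); `pseudoFlowOn_diff_integral` — the same
  for the difference `S̃ − S` of a pseudo-flow and an exact flow;
* `abs_quadTerm_sub_quadTerm_le` — the quadratic term is bilinear:
  `|quadTerm(X)_{i,n} − quadTerm(Y)_{i,n}| ≤ ∑_{i₁,i₂,μ∈S} |α_{i₁i₂iμ}| (1+ε₀)^{5(n−μ₃)/2} (D_a A_b + A_a D_b)`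
  with `a = n−μ₃+μ₁`, `b = n−μ₃+μ₂`, amplitude bounds `A` and difference bounds `D` per shell, and the
  crude three-shell form `abs_quadTerm_sub_quadTerm_le_of_le`
  (`≤ 2 (∑|α_{··i·}|) (1+ε₀)^{5n/2} A* D*` for `ε₀ ≥ 0`);
* `bootstrap_family` — the continuity argument for a family `(u_j)` of real functions on `[0, τ]`
  indexed by an ARBITRARY type: if `u_j(0) ≤ ψ(0) p_j`, if the weak bounds `u_j ≤ 2ψ p_j` on `[0, t]`
  always improve to `u_j(t) ≤ ψ(t) p_j`, and if the family is uniformly Lipschitz relative to the scale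
  `p_j` (`|u_j(t) − u_j(s)| ≤ L p_j |t − s|`) with `ψ` continuous and positive, then `u_j ≤ ψ p_j` on
  `[0, τ]` for every `j`. (With infinitely many shells the usual "first bad time" argument needs exactly
  this uniformity; for the shells at and behind the front it follows from the a priori regularity (4.5)
  of the two flows, the far tail being excluded from the family.)
-/

noncomputable section

-- the sub-problem namespace `Summit.NavierStokesRegularity.NavierStokesRegularity` repeats the summit name by design (D-0017)
set_option linter.dupNamespace false

namespace Summit.NavierStokesRegularity.NavierStokesRegularity.Theorems

open Set MeasureTheory intervalIntegral Literature.Analysis.FluidPDE Literature.Analysis.FluidPDE.TaoCascade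

namespace GappedFrontRobust

variable {m : ℕ}

/-! ### The uniform bootstrap lemma for a family -/

/-- **Uniform bootstrap for a family.** Let `u_j : ℝ → ℝ` (`j` in any index type), scales `p_j ≥ 0`,
`ψ` continuous and positive on `[0, τ]`, `L ≥ 0`. Assume (init) `u_j(0) ≤ ψ(0) p_j`; (improve) for
every `t ∈ [0, τ]`, if `u_j(s) ≤ 2 ψ(s) p_j` for all `j` and all `s ∈ [0, t]` then `u_j(t) ≤ ψ(t) p_j`
for all `j`; (uniform Lipschitz) `|u_j(t) − u_j(s)| ≤ L p_j |t − s|` on `[0, τ]`. Then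
`u_j(t) ≤ ψ(t) p_j` for all `j` and all `t ∈ [0, τ]`. (Induction over steps of a length `η` chosen from
`min ψ > 0`, the uniform continuity of `ψ` and `L`; no continuity of the individual `u_j` beyond the
Lipschitz bound is used.) [folklore] -/
theorem bootstrap_family {ι : Type*} {u : ι → ℝ → ℝ} {p : ι → ℝ} {ψ : ℝ → ℝ} {τ L : ℝ}
    (hp : ∀ j, 0 ≤ p j) (hL : 0 ≤ L) (hψ : ContinuousOn ψ (Icc 0 τ))
    (hψpos : ∀ t ∈ Icc 0 τ, 0 < ψ t)
    (hlip : ∀ j, ∀ s ∈ Icc 0 τ, ∀ t ∈ Icc 0 τ, |u j t - u j s| ≤ L * p j * |t - s|)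
    (h0 : ∀ j, u j 0 ≤ ψ 0 * p j)
    (himp : ∀ t ∈ Icc 0 τ, (∀ j, ∀ s ∈ Icc 0 t, u j s ≤ 2 * ψ s * p j) → ∀ j, u j t ≤ ψ t * p j) :
    ∀ j, ∀ t ∈ Icc 0 τ, u j t ≤ ψ t * p j := by
  -- empty interval / τ < 0 is vacuous; assume 0 ≤ τ
  intro j₀ t₀ ht₀
  have hτ : 0 ≤ τ := ht₀.1.trans ht₀.2
  -- the minimum of ψ on the compact interval
  obtain ⟨tm, htm, hmin⟩ := isCompact_Icc.exists_isMinOn (nonempty_Icc.mpr hτ) hψ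
  set mψ : ℝ := ψ tm with hmψ
  have hmpos : 0 < mψ := hψpos tm htm
  have hmle : ∀ t ∈ Icc 0 τ, mψ ≤ ψ t := fun t ht => hmin ht
  -- uniform continuity of ψ: |t - s| ≤ η₁ ⇒ |ψ t - ψ s| ≤ mψ/2
  have huc := isCompact_Icc.uniformContinuousOn_of_continuous hψ
  rw [Metric.uniformContinuousOn_iff] at huc
  obtain ⟨η₁, hη₁pos, hη₁⟩ := huc (mψ / 2) (by positivity)
  -- the step length
  set η : ℝ := min (η₁ / 2) (mψ / (2 * (L + 1))) with hη
  have hηpos : 0 < η := by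
    have : 0 < mψ / (2 * (L + 1)) := by positivity
    exact lt_min (by positivity) this
  have hη₁' : η < η₁ := by
    have : η ≤ η₁ / 2 := min_le_left _ _
    linarith
  have hηL : L * η ≤ mψ / 2 := by
    have h1 : η ≤ mψ / (2 * (L + 1)) := min_le_right _ _
    have h2 : L * η ≤ L * (mψ / (2 * (L + 1))) := mul_le_mul_of_nonneg_left h1 hL
    have h3 : L * (mψ / (2 * (L + 1))) ≤ mψ / 2 := by
      rw [mul_div_assoc']
      rw [div_le_div_iff₀ (by positivity) (by norm_num)]
      nlinarith
    linarith
  -- induction over the steps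
  have key : ∀ n : ℕ, ∀ j, ∀ t ∈ Icc 0 τ, t ≤ n * η → u j t ≤ ψ t * p j := by
    intro n
    induction n with
    | zero =>
      intro j t ht htn
      have ht0 : t = 0 := le_antisymm (by simpa using htn) ht.1
      rw [ht0]
      exact h0 j
    | succ n ih =>
      intro j t ht htn
      by_cases hle : t ≤ n * η
      · exact ih j t ht hle
      push Not at hle
      -- the anchor s₀ = n η ∈ [0, τ]
      have hs₀ : (n : ℝ) * η ∈ Icc 0 τ := ⟨by positivity, (hle.le.trans ht.2)⟩
      refine himp t ht (fun j' s hs => ?_) j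
      have hsτ : s ∈ Icc 0 τ := ⟨hs.1, hs.2.trans ht.2⟩
      have hψs := hψpos s hsτ
      by_cases hsn : s ≤ n * η
      · have := ih j' s hsτ hsn
        nlinarith [hp j']
      · push Not at hsn
        -- Lipschitz from the anchor
        have hdist : |s - n * η| ≤ η := by
          rw [abs_of_pos (by linarith)]
          push_cast at htn
          linarith [hs.2]
        have h1 := hlip j' _ hs₀ s hsτ
        have h2 : u j' s ≤ u j' (n * η) + L * p j' * η := by
          have ha : u j' s - u j' (n * η) ≤ L * p j' * |s - n * η| := (le_abs_self _).trans h1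
          have hb : L * p j' * |s - n * η| ≤ L * p j' * η :=
            mul_le_mul_of_nonneg_left hdist (mul_nonneg hL (hp j'))
          linarith
        have h3 := ih j' _ hs₀ le_rfl
        -- ψ at the anchor vs ψ at s
        have h4 : ψ (n * η) ≤ ψ s + mψ / 2 := by
          have hd : dist s ((n : ℝ) * η) < η₁ := by
            rw [Real.dist_eq]
            exact lt_of_le_of_lt hdist hη₁'
          have := hη₁ s hsτ _ hs₀ hd
          rw [Real.dist_eq] at this
          linarith [(abs_lt.mp this).1, (abs_lt.mp this).2]
        have h5 : L * p j' * η ≤ mψ / 2 * p j' := by nlinarith [hp j']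
        have h6 := hmle s hsτ
        nlinarith [hp j']
  -- every t ∈ [0, τ] lies below some n η
  obtain ⟨n, hn⟩ := exists_nat_ge (t₀ / η)
  exact key n j₀ t₀ ht₀ (by rwa [div_le_iff₀ hηpos] at hn)

variable {τ ε₀ : ℝ} {α : Fin m → Fin m → Fin m → ℤ × ℤ × ℤ → ℝ} {κ₁ κ₂ κ₂' : ℝ}
  {S₀ F₀ B₀ S₀' F₀' B₀' : Fin m → ℤ → ℝ} {S F S' F' : Fin m → ℤ → ℝ → ℝ}

/-! ### The motion law in integral form -/

/-- Along a pseudo-flow the quadratic terms `t ↦ quadTerm(S)_{i,k}(t)` are continuous on `[0, τ]`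
(finite sums of products of the `C¹` amplitudes). [cite: Tao2016AveragedNS, §4 Lemma 4.1 (4.5), (4.8)] -/
theorem pseudoFlowOn_continuousOn_quadTerm (h : PseudoFlowOn τ ε₀ α κ₁ κ₂ S₀ F₀ B₀ S F) (i : Fin m)
    (k : ℤ) : ContinuousOn (fun t => quadTerm ε₀ α S i k t) (Icc 0 τ) := by
  have hS : ∀ i n, ContinuousOn (S i n) (Icc 0 τ) := fun i n => (h.contDiffOn_S i n).continuousOn
  unfold quadTerm
  refine continuousOn_finsetSum _ fun i₁ _ => continuousOn_finsetSum _ fun i₂ _ =>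
    continuousOn_finsetSum _ fun μ _ => ?_
  exact continuousOn_const.mul ((hS _ _).mul (hS _ _))

/-- **The motion law (4.8) in integral form.** Along a pseudo-flow on `[0, τ]` (`τ > 0`) with motion
defect constant `κ₁`, for every mode, shell and `s ∈ [0, τ]`,
`|S_{i,k}(s) − S₀_{i,k} − ∫₀^s quadTerm(S)_{i,k}(u) du| ≤ ∫₀^s κ₁ (1+ε₀)^{2k} √(F_{i,k}(u)) du`.
[cite: Tao2016AveragedNS, §4 Lemma 4.1 (4.8)] -/
theorem pseudoFlowOn_motion_integral (h : PseudoFlowOn τ ε₀ α κ₁ κ₂ S₀ F₀ B₀ S F) (hτ : 0 < τ)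
    (i : Fin m) (k : ℤ) {s : ℝ} (hs : s ∈ Icc 0 τ) :
    |S i k s - S₀ i k - ∫ u in (0 : ℝ)..s, quadTerm ε₀ α S i k u| ≤
      ∫ u in (0 : ℝ)..s, κ₁ * (1 + ε₀) ^ ((2 : ℝ) * k) * Real.sqrt (F i k u) := by
  have hsubI : Icc 0 s ⊆ Icc 0 τ := Icc_subset_Icc_right hs.2
  have hsub : uIcc 0 s ⊆ Icc 0 τ := by rwa [uIcc_of_le hs.1]
  have hf := h.contDiffOn_S i k
  have hcont : ContinuousOn (S i k) (Icc 0 s) := hf.continuousOn.mono hsubI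
  have hf'cont : ContinuousOn (derivWithin (S i k) (Icc 0 τ)) (Icc 0 τ) :=
    hf.continuousOn_derivWithin (uniqueDiffOn_Icc hτ) le_rfl
  have hderiv : ∀ x ∈ Ioo 0 s, HasDerivAt (S i k) (derivWithin (S i k) (Icc 0 τ) x) x := by
    intro x hx
    have hxτ : x < τ := hx.2.trans_le hs.2
    have hxI : Icc 0 τ ∈ nhds x := Icc_mem_nhds hx.1 hxτ
    have hd : DifferentiableWithinAt ℝ (S i k) (Icc 0 τ) x :=
      (hf.differentiableOn one_ne_zero) x ⟨hx.1.le, hxτ.le⟩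
    rw [derivWithin_of_mem_nhds hxI]
    exact (hd.differentiableAt hxI).hasDerivAt
  have hint' : IntervalIntegrable (derivWithin (S i k) (Icc 0 τ)) volume 0 s :=
    (hf'cont.mono hsub).intervalIntegrable
  have hqint : IntervalIntegrable (fun u => quadTerm ε₀ α S i k u) volume 0 s :=
    ((pseudoFlowOn_continuousOn_quadTerm h i k).mono hsub).intervalIntegrable
  have hdcont : ContinuousOn (fun u => κ₁ * (1 + ε₀) ^ ((2 : ℝ) * k) * Real.sqrt (F i k u))
      (Icc 0 τ) := continuousOn_const.mul (h.contDiffOn_F i k).continuousOn.sqrt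
  have hdint : IntervalIntegrable (fun u => κ₁ * (1 + ε₀) ^ ((2 : ℝ) * k) * Real.sqrt (F i k u))
      volume 0 s := (hdcont.mono hsub).intervalIntegrable
  have hftc := intervalIntegral.integral_eq_sub_of_hasDerivAt_of_le hs.1 hcont hderiv hint'
  rw [h.init_S i k] at hftc
  have heq : S i k s - S₀ i k - ∫ u in (0 : ℝ)..s, quadTerm ε₀ α S i k u =
      ∫ u in (0 : ℝ)..s, (derivWithin (S i k) (Icc 0 τ) u - quadTerm ε₀ α S i k u) := by
    rw [intervalIntegral.integral_sub hint' hqint, hftc]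
  rw [heq]
  calc |∫ u in (0 : ℝ)..s, (derivWithin (S i k) (Icc 0 τ) u - quadTerm ε₀ α S i k u)|
      ≤ ∫ u in (0 : ℝ)..s, |derivWithin (S i k) (Icc 0 τ) u - quadTerm ε₀ α S i k u| :=
        intervalIntegral.abs_integral_le_integral_abs hs.1
    _ ≤ ∫ u in (0 : ℝ)..s, κ₁ * (1 + ε₀) ^ ((2 : ℝ) * k) * Real.sqrt (F i k u) :=
        intervalIntegral.integral_mono_on hs.1 (hint'.sub hqint).abs hdint
          fun u hu => h.motion i k u (hsubI hu)

/-- **Exact flows solve the motion law exactly**: for a defect-free flow (`κ₁ = 0`),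
`S_{i,k}(s) = S₀_{i,k} + ∫₀^s quadTerm(S)_{i,k}` on `[0, τ]`. [cite: Tao2016AveragedNS, §4 Lemma 4.1 (4.8)] -/
theorem pseudoFlowOn_exact_motion_integral (h : PseudoFlowOn τ ε₀ α 0 κ₂ S₀ F₀ B₀ S F) (hτ : 0 < τ)
    (i : Fin m) (k : ℤ) {s : ℝ} (hs : s ∈ Icc 0 τ) :
    S i k s = S₀ i k + ∫ u in (0 : ℝ)..s, quadTerm ε₀ α S i k u := by
  have h1 := pseudoFlowOn_motion_integral h hτ i k hs
  simp only [zero_mul, intervalIntegral.integral_zero] at h1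
  have h2 := abs_nonpos_iff.mp h1
  linarith

/-- **Difference of a pseudo-flow and an exact flow, integral form**: if `S` is a pseudo-flow with
motion defect `κ₁` and `S'` a defect-free flow for the same table on `[0, τ]`, then
`|(S − S')_{i,k}(s) − (S₀ − S₀')_{i,k} − ∫₀^s (quadTerm(S) − quadTerm(S'))_{i,k}| ≤ ∫₀^s κ₁ (1+ε₀)^{2k} √F_{i,k}`.
[cite: Tao2016AveragedNS, §4 Lemma 4.1 (4.8)] -/
theorem pseudoFlowOn_diff_integral (h : PseudoFlowOn τ ε₀ α κ₁ κ₂ S₀ F₀ B₀ S F)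
    (h' : PseudoFlowOn τ ε₀ α 0 κ₂' S₀' F₀' B₀' S' F') (hτ : 0 < τ)
    (i : Fin m) (k : ℤ) {s : ℝ} (hs : s ∈ Icc 0 τ) :
    |(S i k s - S' i k s) - (S₀ i k - S₀' i k) -
        ∫ u in (0 : ℝ)..s, (quadTerm ε₀ α S i k u - quadTerm ε₀ α S' i k u)| ≤
      ∫ u in (0 : ℝ)..s, κ₁ * (1 + ε₀) ^ ((2 : ℝ) * k) * Real.sqrt (F i k u) := by
  have hsub : uIcc 0 s ⊆ Icc 0 τ := by
    rw [uIcc_of_le hs.1]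
    exact Icc_subset_Icc_right hs.2
  have hqint : IntervalIntegrable (fun u => quadTerm ε₀ α S i k u) volume 0 s :=
    ((pseudoFlowOn_continuousOn_quadTerm h i k).mono hsub).intervalIntegrable
  have hqint' : IntervalIntegrable (fun u => quadTerm ε₀ α S' i k u) volume 0 s :=
    ((pseudoFlowOn_continuousOn_quadTerm h' i k).mono hsub).intervalIntegrable
  have h1 := pseudoFlowOn_motion_integral h hτ i k hs
  have h2 := pseudoFlowOn_exact_motion_integral h' hτ i k hs
  rw [intervalIntegral.integral_sub hqint hqint']
  have heq : (S i k s - S' i k s) - (S₀ i k - S₀' i k) -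
      ((∫ u in (0 : ℝ)..s, quadTerm ε₀ α S i k u) - ∫ u in (0 : ℝ)..s, quadTerm ε₀ α S' i k u) =
      S i k s - S₀ i k - ∫ u in (0 : ℝ)..s, quadTerm ε₀ α S i k u := by
    rw [h2]
    ring
  rw [heq]
  exact h1

/-! ### The quadratic term is bilinear: difference bounds -/

/-- **Bilinear difference bound for the quadratic term (shell-resolved).** If `|X_{j,k}(t)|, |Y_{j,k}(t)| ≤ A_k`
and `|X_{j,k}(t) − Y_{j,k}(t)| ≤ D_k` for all modes and shells, then
`|quadTerm(X)_{i,n}(t) − quadTerm(Y)_{i,n}(t)| ≤ ∑_{i₁,i₂} ∑_{μ∈S} |α_{i₁i₂iμ}| (1+ε₀)^{5(n−μ₃)/2} (D_a A_b + A_a D_b)`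
with `a = n−μ₃+μ₁`, `b = n−μ₃+μ₂` (`X_a X_b − Y_a Y_b = (X_a − Y_a) X_b + Y_a (X_b − Y_b)`).
[cite: Tao2016AveragedNS, §4 (4.8) (the bilinear term)] -/
theorem abs_quadTerm_sub_quadTerm_le (ε₀ : ℝ) (hε : 0 < 1 + ε₀)
    (α : Fin m → Fin m → Fin m → ℤ × ℤ × ℤ → ℝ) (X Y : Fin m → ℤ → ℝ → ℝ) (i : Fin m) (n : ℤ)
    (t : ℝ) {A D : ℤ → ℝ} (hAX : ∀ j k, |X j k t| ≤ A k) (hAY : ∀ j k, |Y j k t| ≤ A k)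
    (hD : ∀ j k, |X j k t - Y j k t| ≤ D k) :
    |quadTerm ε₀ α X i n t - quadTerm ε₀ α Y i n t| ≤
      ∑ i₁, ∑ i₂, ∑ μ ∈ shiftSet, |α i₁ i₂ i μ| * (1 + ε₀) ^ ((5 : ℝ) * (n - μ.2.2) / 2) *
        (D (n - μ.2.2 + μ.1) * A (n - μ.2.2 + μ.2.1) +
          A (n - μ.2.2 + μ.1) * D (n - μ.2.2 + μ.2.1)) := by
  have hdiff : quadTerm ε₀ α X i n t - quadTerm ε₀ α Y i n t =
      ∑ i₁, ∑ i₂, ∑ μ ∈ shiftSet, α i₁ i₂ i μ * (1 + ε₀) ^ ((5 : ℝ) * (n - μ.2.2) / 2) *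
        (X i₁ (n - μ.2.2 + μ.1) t * X i₂ (n - μ.2.2 + μ.2.1) t -
          Y i₁ (n - μ.2.2 + μ.1) t * Y i₂ (n - μ.2.2 + μ.2.1) t) := by
    unfold quadTerm
    simp only [← Finset.sum_sub_distrib, ← mul_sub]
  rw [hdiff]
  refine (Finset.abs_sum_le_sum_abs _ _).trans (Finset.sum_le_sum fun i₁ _ => ?_)
  refine (Finset.abs_sum_le_sum_abs _ _).trans (Finset.sum_le_sum fun i₂ _ => ?_)
  refine (Finset.abs_sum_le_sum_abs _ _).trans (Finset.sum_le_sum fun μ _ => ?_)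
  set a : ℤ := n - μ.2.2 + μ.1
  set b : ℤ := n - μ.2.2 + μ.2.1
  have hΛ : 0 ≤ (1 + ε₀) ^ ((5 : ℝ) * (n - μ.2.2) / 2) := (Real.rpow_pos_of_pos hε _).le
  have hprod : |X i₁ a t * X i₂ b t - Y i₁ a t * Y i₂ b t| ≤ D a * A b + A a * D b := by
    have hid : X i₁ a t * X i₂ b t - Y i₁ a t * Y i₂ b t =
        (X i₁ a t - Y i₁ a t) * X i₂ b t + Y i₁ a t * (X i₂ b t - Y i₂ b t) := by ring
    rw [hid]
    refine (abs_add_le _ _).trans (add_le_add ?_ ?_)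
    · rw [abs_mul]
      exact mul_le_mul (hD i₁ a) (hAX i₂ b) (abs_nonneg _) ((abs_nonneg _).trans (hD i₁ a))
    · rw [abs_mul]
      exact mul_le_mul (hAY i₁ a) (hD i₂ b) (abs_nonneg _) ((abs_nonneg _).trans (hAY i₁ a))
  rw [abs_mul, abs_mul, abs_of_nonneg hΛ]
  exact mul_le_mul_of_nonneg_left hprod (mul_nonneg (abs_nonneg _) hΛ)

/-- **Crude three-shell form of the bilinear difference bound** (`ε₀ ≥ 0`): if moreover `A_k ≤ A⋆` and
`D_k ≤ D⋆` on the three shells `n−1, n, n+1`, then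
`|quadTerm(X)_{i,n}(t) − quadTerm(Y)_{i,n}(t)| ≤ 2 (∑_{i₁,i₂,μ} |α_{i₁i₂iμ}|) (1+ε₀)^{5n/2} A⋆ D⋆`.
[cite: Tao2016AveragedNS, §4 (4.8) (the bilinear term)] -/
theorem abs_quadTerm_sub_quadTerm_le_of_le (ε₀ : ℝ) (hε : 0 ≤ ε₀)
    (α : Fin m → Fin m → Fin m → ℤ × ℤ × ℤ → ℝ) (X Y : Fin m → ℤ → ℝ → ℝ) (i : Fin m) (n : ℤ)
    (t : ℝ) {A D : ℤ → ℝ} {Amax Dmax : ℝ} (hAX : ∀ j k, |X j k t| ≤ A k)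
    (hAY : ∀ j k, |Y j k t| ≤ A k) (hD : ∀ j k, |X j k t - Y j k t| ≤ D k)
    (hA3 : ∀ k, n - 1 ≤ k → k ≤ n + 1 → A k ≤ Amax) (hD3 : ∀ k, n - 1 ≤ k → k ≤ n + 1 → D k ≤ Dmax) :
    |quadTerm ε₀ α X i n t - quadTerm ε₀ α Y i n t| ≤
      2 * (∑ i₁, ∑ i₂, ∑ μ ∈ shiftSet, |α i₁ i₂ i μ|) * (1 + ε₀) ^ ((5 : ℝ) * n / 2) *
        Amax * Dmax := by
  have hq : 0 < 1 + ε₀ := by linarith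
  have hq1 : 1 ≤ 1 + ε₀ := by linarith
  refine (abs_quadTerm_sub_quadTerm_le ε₀ hq α X Y i n t hAX hAY hD).trans ?_
  have hterm : ∀ (i₁ i₂ : Fin m), ∀ μ ∈ shiftSet,
      |α i₁ i₂ i μ| * (1 + ε₀) ^ ((5 : ℝ) * (n - μ.2.2) / 2) *
          (D (n - μ.2.2 + μ.1) * A (n - μ.2.2 + μ.2.1) +
            A (n - μ.2.2 + μ.1) * D (n - μ.2.2 + μ.2.1)) ≤
        |α i₁ i₂ i μ| * ((1 + ε₀) ^ ((5 : ℝ) * n / 2) * (2 * Amax * Dmax)) := by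
    intro i₁ i₂ μ hμ
    have hμ' := (mem_shiftSet_iff μ).1 hμ
    -- the shells a, b lie among n-1, n, n+1 and μ₃ ∈ {0, 1}
    have hab : n - 1 ≤ n - μ.2.2 + μ.1 ∧ n - μ.2.2 + μ.1 ≤ n + 1 ∧
        n - 1 ≤ n - μ.2.2 + μ.2.1 ∧ n - μ.2.2 + μ.2.1 ≤ n + 1 ∧ (0 : ℝ) ≤ μ.2.2 := by
      rcases hμ' with rfl | rfl | rfl | rfl <;> simp <;> linarith
    obtain ⟨ha1, ha2, hb1, hb2, hμ3⟩ := hab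
    set a : ℤ := n - μ.2.2 + μ.1
    set b : ℤ := n - μ.2.2 + μ.2.1
    have hA0 : ∀ k, 0 ≤ A k := fun k => (abs_nonneg _).trans (hAX i₁ k)
    have hD0 : ∀ k, 0 ≤ D k := fun k => (abs_nonneg _).trans (hD i₁ k)
    have hΛ : (1 + ε₀) ^ ((5 : ℝ) * (n - μ.2.2) / 2) ≤ (1 + ε₀) ^ ((5 : ℝ) * n / 2) :=
      Real.rpow_le_rpow_of_exponent_le hq1 (by nlinarith)
    have hΛ0 : 0 ≤ (1 + ε₀) ^ ((5 : ℝ) * (n - μ.2.2) / 2) := (Real.rpow_pos_of_pos hq _).le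
    have hin : D a * A b + A a * D b ≤ 2 * Amax * Dmax := by
      have h1 : D a * A b ≤ Dmax * Amax :=
        mul_le_mul (hD3 a ha1 ha2) (hA3 b hb1 hb2) (hA0 b) ((hD0 a).trans (hD3 a ha1 ha2))
      have h2 : A a * D b ≤ Amax * Dmax :=
        mul_le_mul (hA3 a ha1 ha2) (hD3 b hb1 hb2) (hD0 b) ((hA0 a).trans (hA3 a ha1 ha2))
      linarith
    have hin0 : 0 ≤ D a * A b + A a * D b := by
      have := hA0 a; have := hA0 b; have := hD0 a; have := hD0 b; positivity
    rw [mul_assoc]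
    refine mul_le_mul_of_nonneg_left ?_ (abs_nonneg _)
    exact mul_le_mul hΛ hin hin0 (hΛ0.trans hΛ)
  calc ∑ i₁, ∑ i₂, ∑ μ ∈ shiftSet, |α i₁ i₂ i μ| * (1 + ε₀) ^ ((5 : ℝ) * (n - μ.2.2) / 2) *
          (D (n - μ.2.2 + μ.1) * A (n - μ.2.2 + μ.2.1) +
            A (n - μ.2.2 + μ.1) * D (n - μ.2.2 + μ.2.1))
      ≤ ∑ i₁, ∑ i₂, ∑ μ ∈ shiftSet,
          |α i₁ i₂ i μ| * ((1 + ε₀) ^ ((5 : ℝ) * n / 2) * (2 * Amax * Dmax)) :=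
        Finset.sum_le_sum fun i₁ _ => Finset.sum_le_sum fun i₂ _ =>
          Finset.sum_le_sum fun μ hμ => hterm i₁ i₂ μ hμ
    _ = 2 * (∑ i₁, ∑ i₂, ∑ μ ∈ shiftSet, |α i₁ i₂ i μ|) * (1 + ε₀) ^ ((5 : ℝ) * n / 2) *
          Amax * Dmax := by
        simp only [← Finset.sum_mul]
        ring

end GappedFrontRobust

end Summit.NavierStokesRegularity.NavierStokesRegularity.Theorems

end
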